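import Summits.QuantumFields.YangMills.Theorems.EntropyBudgetEquipartitionCovTransfer
import Summits.QuantumFields.YangMills.Theorems.ColdBoxAllGroupsBulkAllGroupsLargeFieldTailG
import HarnessLib

/-!
# Route `EntropyBudgetEquipartition`, crux `EntropyBudgetTransfer` (stmt-QuantumFields-22401) — helper «KT3 → KT»,
# part 2: covariance transfer for the torus Wilson state (the vocabulary of item 22401)

HONEST LABEL: bookkeeping toward a RECORD-label rung (R2ξ-G, `WeakCouplingRates.XiPow`, an UPPER bound on the
lattice gap); the Yang–Mills mass gap is NOT proved by any of this, nor is the crux: the file REDUCES the last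
arrow of the route's plan (KT3 → KT) to its genuine inputs.

Content. `covTransfer_torus` — for a lattice representation `r` of a compact `G` there are `C > 0`, `κ ∈ ℕ`
with: for every torus `Λ_{L+1}` (`L ≥ 1`), `β ≥ 1`, separation `n`, probability space `(E', Q)` carrying a
reference pair `0 ≤ X', Y' ≤ 2Nβ` whose joint law is `δ`-close, on measurable test functions of the pair bounded
by `1`, to the joint law of `(β c₀, β c_n)` under the torus Wilson state `μ_{β,L+1}` (`c₀`, `c_n` = the `(1,2)`
plaquette costs at the origin and at `n e₀`, read through the periodic lift EXACTLY as in item 22401: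
`toTorusObservable (L+1) (plaqCost0 r.ρ 1 2)` and `… ∘ timeShiftLG n`), and every level `m > 0`,
`|β² Cov_{β,L+1}(c₀, c_n) − Cov_Q(X', Y')| ≤ 3m²δ + C β^{κ+2} e^{−m/2} + 8(Nβ)² (Q{m < X'} + Q{m < Y'})`.
The `μ`-side truncation is paid by the tree's all-`G`, volume-uniform single-plaquette tail
`ColdBoxAllGroups.measureReal_plaqCost_ge_le_allSidesG` (`μ{s ≤ c_p} ≤ C β^κ e^{−βs/2}`, Fröhlich–Israel–Lieb–Simon
chessboard + reflection positivity); `covTransfer_torus_of_klDiv` is the same with `δ = √(2D)` for a finite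
relative entropy `D` of the `μ`-pair law with respect to the reference pair law (Pinsker, part 1). With
`m = 2(κ + 3) log β` the `μ`-tail term is `≤ C β^{−1}`, so a reference law at relative entropy `β^{−2κ''}` from the
`μ`-pair law, with covariance `σ C(n)² + O(β^{−κ})` and tails `Q{m < X'} ≤ β^{−3}`, gives the conclusion of
`EntropyBudgetTransfer` at that `(β, n, L)` with exponent `min(κ''/2, 1, κ)` (up to `log² β`): the crux is thereby
REDUCED to producing such a reference law uniformly in `L` — which is KT2 + KT3 + the Gaussian cumulant, none of
them here. Plumbing: `plaqCost0_torusLift`, `plaqCost0_timeShiftLG_torusLift` (the lifted costs are torus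
plaquette costs at `0` and at `n e₀ mod (L+1)`), `plaqCost0_mem` (`0 ≤ c ≤ 2N`, unitarity).

Written by the width seat 2/3 of line `ym-line-ebe-p1` as `--supports stmt-QuantumFields-22401`; no stub of any
registered skeleton is restated. References: J. Fröhlich, R. Israel, E. H. Lieb, B. Simon, CMP 62 (1978) Thm. 4.1
[FrohlichIsraelLiebSimon1978]; Boucheron–Lugosi–Massart 2013 Thm. 4.19 [BoucheronLugosiMassart2013].
-/

set_option autoImplicit false

noncomputable section

open MeasureTheory Set

namespace Summit.QuantumFields.YangMills.Theorems.EntropyBudgetEquipartition.CovTransfer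

/-! ### The torus Wilson state: the `μ`-side tails are the tree's chessboard plaquette tail -/

section Torus

open Literature.MathematicalPhysics.QuantumFieldTheory Literature.MathematicalPhysics.QuantumLattice
open Summit.QuantumFields.YangMills.Theorems.WeakCouplingRates
open Summit.QuantumFields.YangMills.Theorems.ColdBoxAllGroups (measureReal_plaqCost_ge_le_allSidesG)

variable {G : Type} [Group G] [TopologicalSpace G] [IsTopologicalGroup G] [CompactSpace G]
  [MeasurableSpace G] [BorelSpace G]

omit [TopologicalSpace G] [IsTopologicalGroup G] [CompactSpace G] [MeasurableSpace G] [BorelSpace G] in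
/-- Read on the periodic lift, the origin `(1,2)` plaquette cost is the torus plaquette cost at the origin. [folklore] -/
theorem plaqCost0_torusLift {N : ℕ} (ρ : G →* Matrix (Fin N) (Fin N) ℂ) (M : ℕ) (U : GaugeConfig 4 M G) :
    plaqCost0 (d := 4) ρ 1 2 (torusLift M U) = (N : ℝ) - (ρ (plaquetteHolonomy U 0 1 2)).trace.re := by
  have h0 : Literature.Probability.LatticeModels.Torus.proj M (0 : Literature.Probability.LatticeModels.Site 4) = 0 := by
    funext i; simp [Literature.Probability.LatticeModels.Torus.proj]
  simp only [plaqCost0, Literature.MathematicalPhysics.QuantumLattice.plaquetteObs,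
    FreeEnergy.plaquetteHolonomyZd_torusLift, h0]

omit [TopologicalSpace G] [IsTopologicalGroup G] [CompactSpace G] [BorelSpace G] in
/-- Read on the periodic lift, the time-shifted origin plaquette cost is the torus plaquette cost at `n e₀ (mod M)`. [folklore] -/
theorem plaqCost0_timeShiftLG_torusLift {N : ℕ} (ρ : G →* Matrix (Fin N) (Fin N) ℂ) (M n : ℕ)
    (U : GaugeConfig 4 M G) :
    plaqCost0 (d := 4) ρ 1 2 (timeShiftLG (G := G) n (torusLift M U)) =
      (N : ℝ) - (ρ (plaquetteHolonomy U
        (Literature.Probability.LatticeModels.Torus.proj M (Pi.single 0 (n : ℤ))) 1 2)).trace.re := by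
  have hgen : ∀ (v x : Literature.Probability.LatticeModels.Site 4) (W : LGConfig 4 G),
      plaquetteHolonomyZd (configShift v W) x 1 2 = plaquetteHolonomyZd W (x - v) 1 2 := fun v x W => by
    simp only [plaquetteHolonomyZd, configShift_apply, add_sub_right_comm]
  have hshift : plaquetteHolonomyZd (configShift (-(Pi.single 0 (n : ℤ))) (torusLift M U)) 0 1 2 =
      plaquetteHolonomyZd (torusLift M U) (Pi.single 0 (n : ℤ)) 1 2 := by
    rw [hgen, zero_sub, neg_neg]
  simp only [plaqCost0, Literature.MathematicalPhysics.QuantumLattice.plaquetteObs, timeShiftLG, hshift,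
    FreeEnergy.plaquetteHolonomyZd_torusLift]

omit [TopologicalSpace G] [IsTopologicalGroup G] [CompactSpace G] [MeasurableSpace G] [BorelSpace G] in
/-- `0 ≤ N − Re tr ρ(U_p) ≤ 2N` for a unitary `ρ` (the origin cost on `ℤ⁴` configurations). [folklore] -/
theorem plaqCost0_mem {N : ℕ} (ρ : G →* Matrix (Fin N) (Fin N) ℂ) (hρu : ∀ g, ρ g ∈ Matrix.unitaryGroup (Fin N) ℂ)
    (i j : Fin 4) (W : LGConfig 4 G) :
    0 ≤ plaqCost0 (d := 4) ρ i j W ∧ plaqCost0 (d := 4) ρ i j W ≤ 2 * N := by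
  letI : MeasurableSpace G := ⊤
  have h := abs_le.1 (abs_plaquetteObs_le_holds (d := 4) (G := G) ρ hρu 0 i j W)
  simp only [plaqCost0]
  constructor <;> linarith [h.1, h.2]

/-- **Covariance transfer for the torus Wilson state** (crux `EntropyBudgetTransfer`, last arrow `KT3 → KT`).
For a lattice representation `r` of a compact group `G` there are `C > 0`, `κ ∈ ℕ` such that: for every torus
`Λ_{L+1}` (`L ≥ 1`), `β ≥ 1`, separation `n`, every probability space `(E', Q)` with a pair `0 ≤ X', Y' ≤ 2Nβ`
whose joint law is `δ`-close on measurable test functions bounded by `1` to the joint law of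
`(β c₀, β c_n)` under `μ_{β, L+1}` (`c₀`, `c_n` the `(1,2)` plaquette costs at the origin and at `n e₀`, read
through the periodic lift as in item 22401), and every truncation level `m > 0`,
`|β² Cov_{β,L+1}(c₀, c_n) − Cov_Q(X', Y')| ≤ 3 m² δ + C β^{κ+2} e^{−m/2} + 8 (Nβ)² (Q{m < X'} + Q{m < Y'})`.
The `μ`-side truncation is paid by the tree's all-`G` single-plaquette tail
`ColdBoxAllGroups.measureReal_plaqCost_ge_le_allSidesG` (Fröhlich–Israel–Lieb–Simon chessboard).
[cite: FrohlichIsraelLiebSimon1978, Thm. 4.1] -/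
theorem covTransfer_torus (r : LatticeRep G) :
    ∃ C : ℝ, 0 < C ∧ ∃ κ : ℕ, ∀ (L : ℕ), 1 ≤ L → ∀ (β : ℝ), 1 ≤ β → ∀ (n : ℕ)
      {E' : Type*} [MeasurableSpace E'] (Q : Measure E') [IsProbabilityMeasure Q] (X' Y' : E' → ℝ),
      Measurable X' → Measurable Y' → (∀ e, 0 ≤ X' e) → (∀ e, X' e ≤ 2 * r.N * β) →
      (∀ e, 0 ≤ Y' e) → (∀ e, Y' e ≤ 2 * r.N * β) →
      ∀ (m δ : ℝ), 0 < m →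
      (∀ h : ℝ × ℝ → ℝ, Measurable h → (∀ z, |h z| ≤ 1) →
        |wilsonExpectation (L := L + 1) r.ρ β (toTorusObservable (L + 1) fun U =>
            h (β * plaqCost0 (d := 4) r.ρ 1 2 U, β * plaqCost0 (d := 4) r.ρ 1 2 (timeShiftLG (G := G) n U))) -
          ∫ e, h (X' e, Y' e) ∂Q| ≤ δ) →
      |β ^ 2 * (wilsonExpectation (L := L + 1) r.ρ β (toTorusObservable (L + 1) fun U =>
              plaqCost0 (d := 4) r.ρ 1 2 U * plaqCost0 (d := 4) r.ρ 1 2 (timeShiftLG (G := G) n U)) -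
            wilsonExpectation (L := L + 1) r.ρ β (toTorusObservable (L + 1) (plaqCost0 (d := 4) r.ρ 1 2)) *
              wilsonExpectation (L := L + 1) r.ρ β (toTorusObservable (L + 1) fun U =>
                plaqCost0 (d := 4) r.ρ 1 2 (timeShiftLG (G := G) n U))) -
          (∫ e, X' e * Y' e ∂Q - (∫ e, X' e ∂Q) * (∫ e, Y' e ∂Q))| ≤
        3 * m ^ 2 * δ + C * β ^ (κ + 2) * Real.exp (-(m / 2)) +
          8 * ((r.N : ℝ) * β) ^ 2 * (Q.real {e | m < X' e} + Q.real {e | m < Y' e}) := by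
  haveI : SecondCountableTopology G := r.secondCountableTopology
  obtain ⟨C, hC, κ, htail⟩ := measureReal_plaqCost_ge_le_allSidesG r
  refine ⟨16 * (r.N : ℝ) ^ 2 * C + 1, by positivity, κ, ?_⟩
  intro L hL β hβ n E' _ Q _ X' Y' hX'm hY'm hX'0 hX'M hY'0 hY'M m δ hm hclose
  have hβ0 : 0 < β := lt_of_lt_of_le one_pos hβ
  set ρ := r.ρ with hρdef
  set P : Measure (GaugeConfig 4 (L + 1) G) := wilsonMeasure (d := 4) (L := L + 1) ρ β with hP
  haveI : IsProbabilityMeasure P := isProbabilityMeasure_wilsonMeasure (d := 4) (L := L + 1) ρ r.continuous β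
  -- the two observables on the torus
  set X : GaugeConfig 4 (L + 1) G → ℝ := fun U => β * plaqCost0 (d := 4) ρ 1 2 (torusLift (L + 1) U) with hXd
  set Y : GaugeConfig 4 (L + 1) G → ℝ :=
    fun U => β * plaqCost0 (d := 4) ρ 1 2 (timeShiftLG (G := G) n (torusLift (L + 1) U)) with hYd
  have hc : Continuous (plaqCost0 (d := 4) (G := G) ρ 1 2) := (continuous_bounded_plaqCost0 ρ r.continuous 1 2).1
  have hXm : Measurable X :=
    (continuous_const.mul (hc.comp (continuous_torusLift (L + 1)))).measurable
  have hYm : Measurable Y :=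
    (continuous_const.mul (hc.comp ((continuous_timeShiftLG n).comp (continuous_torusLift (L + 1))))).measurable
  have hM : (0 : ℝ) ≤ 2 * r.N * β := by positivity
  have hXb : ∀ U, 0 ≤ X U ∧ X U ≤ 2 * r.N * β := fun U => by
    obtain ⟨h0, h2⟩ := plaqCost0_mem ρ r.mem_unitary 1 2 (torusLift (L + 1) U)
    exact ⟨mul_nonneg hβ0.le h0, by rw [hXd]; nlinarith⟩
  have hYb : ∀ U, 0 ≤ Y U ∧ Y U ≤ 2 * r.N * β := fun U => by
    obtain ⟨h0, h2⟩ := plaqCost0_mem ρ r.mem_unitary 1 2 (timeShiftLG (G := G) n (torusLift (L + 1) U))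
    exact ⟨mul_nonneg hβ0.le h0, by rw [hYd]; nlinarith⟩
  -- closeness, in integral form
  have hclose' : ∀ h : ℝ × ℝ → ℝ, Measurable h → (∀ z, |h z| ≤ 1) →
      |∫ U, h (X U, Y U) ∂P - ∫ e, h (X' e, Y' e) ∂Q| ≤ δ := by
    intro h hh hb
    have := hclose h hh hb
    simpa only [wilsonExpectation, toTorusObservable_apply] using this
  -- the abstract transfer
  have habs := abs_cov_sub_cov_le (P := P) (Q := Q) hXm hYm hX'm hY'm hM (fun U => (hXb U).1)
    (fun U => (hXb U).2) (fun U => (hYb U).1) (fun U => (hYb U).2) hX'0 hX'M hY'0 hY'M hm hclose'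
  -- the μ-side tails
  have hL2 : 2 ≤ L + 1 := by omega
  have hs : 0 ≤ m / β := div_nonneg hm.le hβ0.le
  have h12 : (1 : Fin 4) ≠ 2 := by decide
  have tX : P.real {U | m < X U} ≤ C * β ^ κ * Real.exp (-(m / 2)) := by
    have hsub : {U | m < X U} ⊆ {U : GaugeConfig 4 (L + 1) G |
        m / β ≤ (r.N : ℝ) - (r.ρ (plaquetteHolonomy U 0 1 2)).trace.re} := by
      intro U hU
      simp only [Set.mem_setOf_eq] at hU ⊢
      rw [hXd] at hU
      simp only [plaqCost0_torusLift] at hU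
      rw [div_le_iff₀ hβ0]
      linarith
    have h1 := htail (L := L + 1) hL2 β hβ (m / β) hs (0 : Site 4 (L + 1)) h12
    have e1 : β * (m / β) / 2 = m / 2 := by field_simp
    rw [e1] at h1
    exact (measureReal_mono hsub).trans h1
  have tY : P.real {U | m < Y U} ≤ C * β ^ κ * Real.exp (-(m / 2)) := by
    have hsub : {U | m < Y U} ⊆ {U : GaugeConfig 4 (L + 1) G |
        m / β ≤ (r.N : ℝ) - (r.ρ (plaquetteHolonomy U
          (Literature.Probability.LatticeModels.Torus.proj (L + 1) (Pi.single 0 (n : ℤ))) 1 2)).trace.re} := by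
      intro U hU
      simp only [Set.mem_setOf_eq] at hU ⊢
      rw [hYd] at hU
      simp only [plaqCost0_timeShiftLG_torusLift] at hU
      rw [div_le_iff₀ hβ0]
      linarith
    have h1 := htail (L := L + 1) hL2 β hβ (m / β) hs
      (Literature.Probability.LatticeModels.Torus.proj (L + 1) (Pi.single 0 (n : ℤ))) h12
    have e1 : β * (m / β) / 2 = m / 2 := by field_simp
    rw [e1] at h1
    exact (measureReal_mono hsub).trans h1
  -- rewrite the goal in terms of `X`, `Y`
  have iXY : ∫ U, X U * Y U ∂P = β ^ 2 * wilsonExpectation (L := L + 1) ρ β (toTorusObservable (L + 1) fun U =>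
      plaqCost0 (d := 4) ρ 1 2 U * plaqCost0 (d := 4) ρ 1 2 (timeShiftLG (G := G) n U)) := by
    simp only [wilsonExpectation, toTorusObservable_apply, hXd, hYd, hP, ← integral_const_mul]
    congr 1; funext U; ring
  have iX : ∫ U, X U ∂P = β * wilsonExpectation (L := L + 1) ρ β (toTorusObservable (L + 1) (plaqCost0 (d := 4) ρ 1 2)) := by
    simp only [wilsonExpectation, toTorusObservable_apply, hXd, hP, ← integral_const_mul]
  have iY : ∫ U, Y U ∂P = β * wilsonExpectation (L := L + 1) ρ β (toTorusObservable (L + 1) fun U =>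
      plaqCost0 (d := 4) ρ 1 2 (timeShiftLG (G := G) n U)) := by
    simp only [wilsonExpectation, toTorusObservable_apply, hYd, hP, ← integral_const_mul]
  rw [iXY, iX, iY] at habs
  have e3 : β ^ 2 * (wilsonExpectation (L := L + 1) ρ β (toTorusObservable (L + 1) fun U =>
              plaqCost0 (d := 4) ρ 1 2 U * plaqCost0 (d := 4) ρ 1 2 (timeShiftLG (G := G) n U)) -
            wilsonExpectation (L := L + 1) ρ β (toTorusObservable (L + 1) (plaqCost0 (d := 4) ρ 1 2)) *
              wilsonExpectation (L := L + 1) ρ β (toTorusObservable (L + 1) fun U =>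
                plaqCost0 (d := 4) ρ 1 2 (timeShiftLG (G := G) n U))) =
      β ^ 2 * wilsonExpectation (L := L + 1) ρ β (toTorusObservable (L + 1) fun U =>
              plaqCost0 (d := 4) ρ 1 2 U * plaqCost0 (d := 4) ρ 1 2 (timeShiftLG (G := G) n U)) -
        β * wilsonExpectation (L := L + 1) ρ β (toTorusObservable (L + 1) (plaqCost0 (d := 4) ρ 1 2)) *
          (β * wilsonExpectation (L := L + 1) ρ β (toTorusObservable (L + 1) fun U =>
            plaqCost0 (d := 4) ρ 1 2 (timeShiftLG (G := G) n U))) := by ring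
  rw [e3]
  refine habs.trans ?_
  -- arithmetic of the error terms
  have hpX : 0 ≤ Q.real {e | m < X' e} := measureReal_nonneg
  have hpY : 0 ≤ Q.real {e | m < Y' e} := measureReal_nonneg
  have hexp : 0 ≤ Real.exp (-(m / 2)) := (Real.exp_pos _).le
  have hβκ : 0 ≤ β ^ κ := pow_nonneg hβ0.le κ
  have hsum : P.real {U | m < X U} + P.real {U | m < Y U} ≤ 2 * (C * β ^ κ * Real.exp (-(m / 2))) := by linarith
  have hstep : 2 * (2 * r.N * β) ^ 2 * (P.real {U | m < X U} + P.real {U | m < Y U} +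
        Q.real {e | m < X' e} + Q.real {e | m < Y' e}) ≤
      (16 * (r.N : ℝ) ^ 2 * C + 1) * β ^ (κ + 2) * Real.exp (-(m / 2)) +
        8 * ((r.N : ℝ) * β) ^ 2 * (Q.real {e | m < X' e} + Q.real {e | m < Y' e}) := by
    have e4 : 2 * (2 * r.N * β) ^ 2 * (P.real {U | m < X U} + P.real {U | m < Y U} +
          Q.real {e | m < X' e} + Q.real {e | m < Y' e}) =
        8 * ((r.N : ℝ) * β) ^ 2 * (P.real {U | m < X U} + P.real {U | m < Y U}) +
          8 * ((r.N : ℝ) * β) ^ 2 * (Q.real {e | m < X' e} + Q.real {e | m < Y' e}) := by ring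
    rw [e4]
    have e5 : 8 * ((r.N : ℝ) * β) ^ 2 * (2 * (C * β ^ κ * Real.exp (-(m / 2)))) =
        16 * (r.N : ℝ) ^ 2 * C * β ^ (κ + 2) * Real.exp (-(m / 2)) := by ring
    have h8 : 0 ≤ 8 * ((r.N : ℝ) * β) ^ 2 := by positivity
    have h9 := mul_le_mul_of_nonneg_left hsum h8
    rw [e5] at h9
    have h10 : 0 ≤ β ^ (κ + 2) * Real.exp (-(m / 2)) := by positivity
    nlinarith
  linarith

/-- **Covariance transfer for the torus Wilson state from an ENTROPY bound** (`KT3 → KT` in the form the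
route's plan produces it): as `covTransfer_torus`, with the closeness hypothesis replaced by a finite relative
entropy `D` of the joint law of `(β c₀, β c_n)` under `μ_{β,L+1}` with respect to the joint law of the
reference pair `(X', Y')` under `Q`; the price is `δ = √(2D)` (Pinsker). [cite: BoucheronLugosiMassart2013, §4.11 Thm. 4.19] -/
theorem covTransfer_torus_of_klDiv (r : LatticeRep G) :
    ∃ C : ℝ, 0 < C ∧ ∃ κ : ℕ, ∀ (L : ℕ), 1 ≤ L → ∀ (β : ℝ), 1 ≤ β → ∀ (n : ℕ)
      {E' : Type*} [MeasurableSpace E'] (Q : Measure E') [IsProbabilityMeasure Q] (X' Y' : E' → ℝ),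
      Measurable X' → Measurable Y' → (∀ e, 0 ≤ X' e) → (∀ e, X' e ≤ 2 * r.N * β) →
      (∀ e, 0 ≤ Y' e) → (∀ e, Y' e ≤ 2 * r.N * β) →
      ∀ (m : ℝ), 0 < m →
      InformationTheory.klDiv
          ((wilsonMeasure (d := 4) (L := L + 1) r.ρ β).map fun U =>
            (β * plaqCost0 (d := 4) r.ρ 1 2 (torusLift (L + 1) U),
              β * plaqCost0 (d := 4) r.ρ 1 2 (timeShiftLG (G := G) n (torusLift (L + 1) U))))
          (Q.map fun e => (X' e, Y' e)) ≠ ⊤ →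
      |β ^ 2 * (wilsonExpectation (L := L + 1) r.ρ β (toTorusObservable (L + 1) fun U =>
              plaqCost0 (d := 4) r.ρ 1 2 U * plaqCost0 (d := 4) r.ρ 1 2 (timeShiftLG (G := G) n U)) -
            wilsonExpectation (L := L + 1) r.ρ β (toTorusObservable (L + 1) (plaqCost0 (d := 4) r.ρ 1 2)) *
              wilsonExpectation (L := L + 1) r.ρ β (toTorusObservable (L + 1) fun U =>
                plaqCost0 (d := 4) r.ρ 1 2 (timeShiftLG (G := G) n U))) -
          (∫ e, X' e * Y' e ∂Q - (∫ e, X' e ∂Q) * (∫ e, Y' e ∂Q))| ≤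
        3 * m ^ 2 * Real.sqrt (2 * (InformationTheory.klDiv
          ((wilsonMeasure (d := 4) (L := L + 1) r.ρ β).map fun U =>
            (β * plaqCost0 (d := 4) r.ρ 1 2 (torusLift (L + 1) U),
              β * plaqCost0 (d := 4) r.ρ 1 2 (timeShiftLG (G := G) n (torusLift (L + 1) U))))
          (Q.map fun e => (X' e, Y' e))).toReal) +
          C * β ^ (κ + 2) * Real.exp (-(m / 2)) +
          8 * ((r.N : ℝ) * β) ^ 2 * (Q.real {e | m < X' e} + Q.real {e | m < Y' e}) := by
  haveI : SecondCountableTopology G := r.secondCountableTopology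
  obtain ⟨C, hC, κ, H⟩ := covTransfer_torus r
  refine ⟨C, hC, κ, ?_⟩
  intro L hL β hβ n E' _ Q _ X' Y' hX'm hY'm hX'0 hX'M hY'0 hY'M m hm hkl
  haveI : IsProbabilityMeasure (wilsonMeasure (d := 4) (L := L + 1) r.ρ β) :=
    isProbabilityMeasure_wilsonMeasure (d := 4) (L := L + 1) r.ρ r.continuous β
  have hc : Continuous (plaqCost0 (d := 4) (G := G) r.ρ 1 2) := (continuous_bounded_plaqCost0 r.ρ r.continuous 1 2).1
  have hXm : Measurable fun U : GaugeConfig 4 (L + 1) G => β * plaqCost0 (d := 4) r.ρ 1 2 (torusLift (L + 1) U) :=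
    (continuous_const.mul (hc.comp (continuous_torusLift (L + 1)))).measurable
  have hYm : Measurable fun U : GaugeConfig 4 (L + 1) G =>
      β * plaqCost0 (d := 4) r.ρ 1 2 (timeShiftLG (G := G) n (torusLift (L + 1) U)) :=
    (continuous_const.mul (hc.comp ((continuous_timeShiftLG n).comp (continuous_torusLift (L + 1))))).measurable
  refine H L hL β hβ n Q X' Y' hX'm hY'm hX'0 hX'M hY'0 hY'M m _ hm fun h hh hb => ?_
  have hbr := abs_integral_pair_sub_le_sqrt_klDiv_map (P := wilsonMeasure (d := 4) (L := L + 1) r.ρ β) (Q := Q)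
    hXm hYm hX'm hY'm hkl h hh hb
  simpa only [wilsonExpectation, toTorusObservable_apply] using hbr

end Torus

end Summit.QuantumFields.YangMills.Theorems.EntropyBudgetEquipartition.CovTransfer

end
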